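import Summits.QuantumFields.YangMills.Theorems.FlatTubeReductionPinnedUnitStepExDefs
import Summits.QuantumFields.YangMills.Theorems.FlatTubeReductionPinnedUnitStepExGroundState
import Summits.QuantumFields.YangMills.Theorems.FlatTubeReductionUnitLadder
import HarnessLib

/-!
# Route `FlatTubeReduction`, crux `PinnedUnitStepEx` (stmt-QuantumFields-27561) — THE DOOR of stub 1: `WInjUnit → SmearVarPosGS1`

Seat ym-line-fcl-p3 g9 (2026-08-28).  Registered skeleton «ti-split-1» (planner ym-idea-1 g6); stub Props and the named-kinematics core `WInjUnit`
in `Theorems/FlatTubeReductionPinnedUnitStepExDefs.lean` (p633258).  This file reduces the registered kinematic stub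
`stub_smearVarPosGS1 : SmearVarPosGS1` to EXACTLY the lattice-combinatorial statement `WInjUnit` (memo `WINJ-m1-proof-fcl-p3-g9.md` §4, evidence on
the item): given the item's data, the coarse ground state `Ω′` is translation invariant (`GroundStateUnique.groundState_translationInvariant`,
Perron–Frobenius uniqueness), hence `g := φ′/Ω′` is a bounded measurable gauge- and translation-invariant coarse observable, not a.e. constant
(`⟨φ′,Ω′⟩ = 0`, `‖φ′‖ = 1`, `Ω′ > 0`); `WInjUnit` says its smeared pull-back `fbar = |Λ|⁻¹ Σ_v g ∘ thin L′ ∘ τ_v` is not a.e. constant; the strict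
Cauchy–Schwarz step (`GroundStateUnique.l2_mul_sq_lt_of_not_ae_const`) gives `⟨fbar·Ω, Ω⟩² < ‖fbar·Ω‖²`; the inline thinning/shift of the stub are
the tree's `thin`/`torusConfigShift` (`thin_eq_pinnedInline`, `torusConfigShift_eq_pinnedInline`).  Once `wInjUnit_holds : WInjUnit` lands,
`stub_smearVarPosGS1 := smearVarPosGS1_of_wInjUnit wInjUnit_holds`.  R2b1 RECORD rung; nothing here is a summit, a crux or the stub itself.
-/

set_option autoImplicit false

noncomputable section

namespace Summit.QuantumFields.YangMills.Cruxes.PinnedUnitStepEx.TISplit1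

open MeasureTheory
open Literature.MathematicalPhysics.QuantumFieldTheory (Site Edge GaugeConfig gaugeTransform)
open Literature.MathematicalPhysics.QuantumFieldTheory.TorusTranslation
open Summit.QuantumFields.YangMills.Theorems.FemtoTransferGap
open Summit.QuantumFields.YangMills.Theorems.FemtoCutoffLadder
open Summit.QuantumFields.YangMills.Theorems.FemtoCutoffLadder.Thinning (thin)
open Summit.QuantumFields.YangMills.Theorems.FlatTubeReduction

/-- ★★ **THE DOOR of stub 1**: `WInjUnit → SmearVarPosGS1`.  Given the item's data, `Ω′` is translation invariant
(`GroundStateUnique.groundState_translationInvariant`), so `g := φ′/Ω′` is a bounded measurable gauge-invariant translation-invariant coarse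
observable which is not a.e. constant (`⟨φ′,Ω′⟩ = 0`, `‖φ′‖ = 1`, `Ω′ > 0`); `WInjUnit` makes the smeared trial `fbar = |Λ|⁻¹ Σ_v g ∘ thin ∘ τ_v`
not a.e. constant, and the strict Cauchy–Schwarz step `GroundStateUnique.l2_mul_sq_lt_of_not_ae_const` gives `⟨fbar Ω, Ω⟩² < ‖fbar Ω‖²`
(inline thinning/shift = `thin`/`torusConfigShift` by `thin_eq_pinnedInline`, `torusConfigShift_eq_pinnedInline`). [folklore] -/
theorem smearVarPosGS1_of_wInjUnit (hW : WInjUnit) : SmearVarPosGS1 := by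
  intro L' _ β' Ω hΩ hΩpos hΩn Ω' hΩ' c' hc' hc'le hΩ'n hΩ'eig φ' hφ' hTI horth hn1
  simp only []
  have hLL : L' ≤ L' + 1 := Nat.le_succ _
  have h2 : L' + 1 ≤ 2 * L' := by have := NeZero.one_le (n := L'); omega
  have hΩ'pos : ∀ U', 0 < Ω' U' := fun U' => hc'.trans_le (hc'le U')
  obtain ⟨hrm, ⟨Cg, hrb⟩, hrg, hrz, -⟩ := Dirichlet.ratio_multiplier hΩ' hφ' hc' hc'le
  have hratio : IsPhys (fun U' : GaugeConfig 3 L' SU2 => φ' U' / Ω' U') := ⟨hrm, ⟨Cg, hrb⟩, hrg, hrz⟩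
  -- `Ω′`, hence `g = φ′/Ω′`, is translation invariant
  have hΩ'TI := GroundStateUnique.groundState_translationInvariant β' hΩ' hΩ'pos hΩ'n hΩ'eig
  have hgTI : ∀ (v' : Site 3 L') (U' : GaugeConfig 3 L' SU2),
      φ' (torusConfigShift v' U') / Ω' (torusConfigShift v' U') = φ' U' / Ω' U' := by
    intro v' U'
    rw [torusConfigShift_eq_pinnedInline, hTI v' U', hΩ'TI v' U']
  -- `g` is not a.e. constant
  have hgnc : ∀ c : ℝ, ¬ ((fun U' : GaugeConfig 3 L' SU2 => φ' U' / Ω' U') =ᵐ[configMeasure SU2 L'] fun _ => c) := by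
    intro c hc
    have hφc : φ' =ᵐ[configMeasure SU2 L'] c • Ω' := hc.mono fun U' hU' => by
      have hne : Ω' U' ≠ 0 := (hΩ'pos U').ne'
      have h' : φ' U' / Ω' U' = c := hU'
      rw [Pi.smul_apply, smul_eq_mul, ← h', div_mul_cancel₀ _ hne]
    have h0 : c = 0 := by
      have := horth
      rwa [GroundStateUnique.l2_congr_ae_left hφc, l2_smul_left, hΩ'n, mul_one] at this
    have hφ0 : φ' =ᵐ[configMeasure SU2 L'] (0 : ℝ) • Ω' := h0 ▸ hφc
    have : l2 φ' φ' = 0 := by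
      rw [GroundStateUnique.l2_congr_ae_left hφ0, l2_smul_left, zero_mul]
    rw [this] at hn1
    exact zero_ne_one hn1
  -- W-inj: the translation SUM of the pull-backs is not a.e. constant
  have hS := hW L' (fun U' => φ' U' / Ω' U') hrm ⟨Cg, hrb⟩ hrg hgTI hgnc
  -- hence neither is the AVERAGE `fbar`
  have havg := Thinning.isPhys_avg_thin_shift (G := SU2) hLL h2 hratio
  have hcard : (0 : ℝ) < (Fintype.card (Site 3 (L' + 1)) : ℝ) := by exact_mod_cast Fintype.card_pos
  have hfnc : ∀ c : ℝ, ¬ ((fun U : GaugeConfig 3 (L' + 1) SU2 =>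
      (Fintype.card (Site 3 (L' + 1)) : ℝ)⁻¹ * ∑ v : Site 3 (L' + 1), φ' (thin L' (torusConfigShift v U)) / Ω' (thin L' (torusConfigShift v U)))
        =ᵐ[configMeasure SU2 (L' + 1)] fun _ => c) := by
    intro c hc
    refine hS (Fintype.card (Site 3 (L' + 1)) * c) (hc.mono fun U hU => ?_)
    have hU' : (Fintype.card (Site 3 (L' + 1)) : ℝ)⁻¹ *
        ∑ v : Site 3 (L' + 1), φ' (thin L' (torusConfigShift v U)) / Ω' (thin L' (torusConfigShift v U)) = c := hU
    have := congrArg (fun x => (Fintype.card (Site 3 (L' + 1)) : ℝ) * x) hU'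
    simp only [← mul_assoc, mul_inv_cancel₀ hcard.ne', one_mul] at this
    exact this
  have key := GroundStateUnique.l2_mul_sq_lt_of_not_ae_const _ Ω havg hΩ hΩpos hΩn hfnc
  simp only [torusConfigShift_eq_pinnedInline, thin_eq_pinnedInline] at key
  exact key

end Summit.QuantumFields.YangMills.Cruxes.PinnedUnitStepEx.TISplit1
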